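import Mathlib.Geometry.Manifold.ContMDiffMFDeriv
import Mathlib.Geometry.Manifold.VectorBundle.Hom
import Mathlib.Analysis.Calculus.LocalExtr.Basic
import Mathlib.Analysis.Calculus.ContDiff.FiniteDimension
import Literature.Geometry.Lorentzian.Causality
import HarnessLib

/-!
# Push-up fails on manifolds with boundary: `chronologicalFuture_causalFuture` is false as vendored

The named fact `Literature.Geometry.Lorentzian.LorentzianMetric.chronologicalFuture_causalFuture` of
`Literature.Geometry.Lorentzian.Causality` vendors the push-up lemma `I⁺(J⁺(S)) = I⁺(S)`
(O'Neill 1983, Ch. 14, Cor. 14.1, pp. 402–403: "if `x ≤ y` and `y ≪ z` then `x ≪ z`", summarised as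
`I⁺(A) = I⁺(J⁺A)`; proved from Ch. 10, Prop. 10.46). O'Neill's standing hypothesis (Ch. 14,
p. 402) is that `M` is a spacetime: a connected time-oriented Lorentz manifold — smooth,
finite-dimensional, Hausdorff, **without boundary**. The vendored `def` is stated in a section with
`[FiniteDimensional ℝ E] [T2Space M] [BoundarylessManifold I M]`, but instance-implicit section
variables that the body does not use are not bound by a `def`, so the constant quantifies over
every model with corners `I` (cf. the remark before `HasFutureEndpoint` in that file). This file
shows that the resulting statement is **false**: push-up fails on a Lorentzian surface with
boundary.

## The counterexample (`HalfPlane`)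

On the closed half-plane `ℍ = EuclideanHalfSpace 2 = {(v, u) : 0 ≤ v}` (model `𝓡∂ 2`) take the
smooth Lorentzian metric and time orientation
`g = dv² + 2ψ du dv + (ψ² - 1) du² = d(v + u - u³/3)² - du²`, `ψ(u) = 1 - u²`, `T = ∂ᵤ - ψ ∂ᵥ`
(`g(T, T) = -1`, `g(T, a) = -aᵤ`); i.e. `ℍ` is the region `x ≥ u - u³/3` of the Minkowski plane
`dx² - du²` (time `u`), whose boundary curve has slope `ψ`: null at `u = 0`, timelike for
`0 < u² < 2`. Let `p = (0, 0)`.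
* Every curve `γ : ℝ → ℍ` differentiable at a parameter where it passes through `p` has velocity
  tangent to the boundary there (its `v`-coordinate `≥ 0` is minimal, Fermat), i.e. `α ∂ᵤ`, and
  `g_p(∂ᵤ, ∂ᵤ) = ψ(0)² - 1 = 0`: **no timelike curve starts at `p`**, `I⁺({p}) = ∅`
  (`HalfPlane.chronologicalFuture_eq_empty`).
* The boundary curve `γ₁(s) = (0, s)` is future causal on `[0, 1]` (`g(γ₁', γ₁') = ψ² - 1 ≤ 0`), so
  `p' = (0, 1) ∈ J⁺({p})`; and `γ₂(s) = (s², 1 + s)` is future timelike on `[0, 1/2]`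
  (`g(γ₂', γ₂') = s⁴ - 1`), so `q = (1/4, 3/2) ∈ I⁺({p'}) ⊆ I⁺(J⁺({p}))`.
Hence `I⁺(J⁺({p})) ≠ I⁺({p})` (`HalfPlane.not_chronologicalFuture_causalFuture`); the same example
refutes the vendored `causalFuture_subset_closure_chronologicalFuture` (`J⁺ S ⊆ closure (I⁺ S)`,
O'Neill Lemma 14.6), since `p ∈ J⁺({p})` while `I⁺({p}) = ∅`.

Curves are handled through their coordinate expressions: for `γ : ℝ → ℍ` the chart expression is
`t ↦ (γ t : ℝ²)` and `velocity (𝓡∂ 2) γ t` is its ordinary derivative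
(`HalfPlane.hasDerivAt_val_of_mdifferentiableAt`, `HalfPlane.velocity_pt`). Smoothness of `g` and
`T` as bundle sections is checked in the (identity) trivialisations of the model space, as in
Mathlib's `riemannianMetricVectorSpace`. A faithful restatement of Cor. 14.1 must bind
`[BoundarylessManifold I M]` (and finite dimension, Hausdorff) inside the `Prop`.

## References

* B. O'Neill, *Semi-Riemannian geometry with applications to relativity*, Academic Press 1983,
  Ch. 14, pp. 402–403 (causality relations, Cor. 14.1), Lemma 14.6 (p. 404); Ch. 10, Prop. 10.46
  (p. 294).
-/

noncomputable section

open Bundle Set Filter Function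
open scoped Manifold ContDiff Topology

-- `TangentSpace I x` is definitionally the model vector space; the file constantly moves vectors
-- across this identification (as Mathlib's `Geometry.Manifold.Riemannian.Basic` does).
set_option backward.isDefEq.respectTransparency false

namespace Literature.Geometry.Lorentzian

namespace HalfPlane

/-! ### The metric coefficients on `ℝ²` -/

/-- The coefficient `ψ(y) = 1 - u²` of the half-plane metric at the point `y = (v, u)` of `ℝ²`
(coordinate `0` is `v`, coordinate `1` is `u`). [folklore] -/
def ψ (y : EuclideanSpace ℝ (Fin 2)) : ℝ := 1 - (y 1) ^ 2

/-- `ψ` is smooth. [folklore] -/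
lemma contDiff_ψ : ContDiff ℝ ∞ ψ := by
  unfold ψ; fun_prop

/-- The bilinear form `g_y(a, b) = a₀ b₀ + ψ(y) (a₀ b₁ + a₁ b₀) + (ψ(y)² - 1) a₁ b₁` on `ℝ²`
(determinant `-1`, hence Lorentzian). [folklore] -/
def bilin (y : EuclideanSpace ℝ (Fin 2)) :
    EuclideanSpace ℝ (Fin 2) →L[ℝ] EuclideanSpace ℝ (Fin 2) →L[ℝ] ℝ :=
  (EuclideanSpace.proj 0).smulRight (EuclideanSpace.proj 0) +
    ψ y • ((EuclideanSpace.proj 0).smulRight (EuclideanSpace.proj 1) +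
      (EuclideanSpace.proj 1).smulRight (EuclideanSpace.proj 0)) +
    (ψ y ^ 2 - 1) • (EuclideanSpace.proj 1).smulRight (EuclideanSpace.proj 1)

/-- The value `g_y(a, b)` in coordinates. [folklore] -/
@[simp]
lemma bilin_apply (y a b : EuclideanSpace ℝ (Fin 2)) :
    bilin y a b = a 0 * b 0 + ψ y * (a 0 * b 1 + a 1 * b 0) + (ψ y ^ 2 - 1) * (a 1 * b 1) := by
  simp only [bilin, add_apply, smul_apply, ContinuousLinearMap.smulRight_apply,
    EuclideanSpace.coe_proj, smul_eq_mul]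

/-- `y ↦ g_y` is smooth (its matrix entries are polynomials). [folklore] -/
lemma contDiff_bilin : ContDiff ℝ ∞ bilin := by
  refine contDiff_clm_apply_iff.mpr fun a ↦ contDiff_clm_apply_iff.mpr fun b ↦ ?_
  simp only [bilin_apply]
  unfold ψ
  fun_prop

/-- Nondegeneracy of `bilin y` (its determinant is `-1`). [folklore] -/
lemma bilin_nondegenerate (y a : EuclideanSpace ℝ (Fin 2)) (ha : ∀ b, bilin y a b = 0) : a = 0 := by
  have h0 := ha (EuclideanSpace.single 0 1)
  have h1 := ha (EuclideanSpace.single 1 1)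
  simp only [bilin_apply, PiLp.single_apply, Fin.isValue, ↓reduceIte, mul_one, one_ne_zero,
    mul_zero, add_zero, zero_add, zero_ne_one] at h0 h1
  have ha1 : a 1 = 0 := by linear_combination ψ y * h0 - h1
  have ha0 : a 0 = 0 := by linear_combination h0 - ψ y * ha1
  ext i
  fin_cases i
  · simpa using ha0
  · simpa using ha1

/-- Completing the square: in the frame `X = a₀ + ψ a₁`, `Y = a₁` the form `bilin y` is the
Minkowski form `X X' - Y Y'` (indeed `g = d(v + u - u³/3)² - du²`). [folklore] -/
lemma bilin_eq (y a b : EuclideanSpace ℝ (Fin 2)) :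
    bilin y a b = (a 0 + ψ y * a 1) * (b 0 + ψ y * b 1) - a 1 * b 1 := by
  rw [bilin_apply]
  ring

/-- The `bilin y`-orthogonal complement of a timelike vector is positive definite (reverse
Cauchy–Schwarz in the Minkowski plane). [folklore] -/
lemma bilin_pos_of_orthogonal (y a b : EuclideanSpace ℝ (Fin 2)) (ha : bilin y a a < 0)
    (hab : bilin y a b = 0) (hb : b ≠ 0) : 0 < bilin y b b := by
  rw [bilin_eq] at ha hab ⊢
  by_cases hb1 : b 1 = 0
  · have hb0 : b 0 ≠ 0 := fun hb0 ↦ hb (by ext i; fin_cases i <;> simp [hb0, hb1])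
    simp only [hb1, mul_zero, add_zero, sub_zero]
    exact mul_self_pos.mpr hb0
  · have hsq : (a 0 + ψ y * a 1) ^ 2 * (b 0 + ψ y * b 1) ^ 2 = a 1 ^ 2 * b 1 ^ 2 := by
      rw [← mul_pow, ← mul_pow, sub_eq_zero.mp hab]
    have hb1' : 0 < b 1 ^ 2 := by positivity
    nlinarith [mul_le_mul_of_nonneg_left (le_of_lt ha) (sq_nonneg (b 0 + ψ y * b 1)),
      mul_lt_mul_of_pos_right (show (a 0 + ψ y * a 1) ^ 2 < a 1 ^ 2 by nlinarith) hb1']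

/-- The vector `T(y) = ∂ᵤ - ψ(y) ∂ᵥ`, the time orientation of the half-plane metric. [folklore] -/
def vecT (y : EuclideanSpace ℝ (Fin 2)) : EuclideanSpace ℝ (Fin 2) :=
  EuclideanSpace.single 1 1 - ψ y • EuclideanSpace.single 0 1

/-- `T` has `v`-component `-ψ`. [folklore] -/
@[simp] lemma vecT_apply_zero (y : EuclideanSpace ℝ (Fin 2)) : vecT y 0 = -ψ y := by
  simp [vecT]

/-- `T` has `u`-component `1`. [folklore] -/
@[simp] lemma vecT_apply_one (y : EuclideanSpace ℝ (Fin 2)) : vecT y 1 = 1 := by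
  simp [vecT]

/-- `T` is smooth. [folklore] -/
lemma contDiff_vecT : ContDiff ℝ ∞ vecT := by
  unfold vecT
  exact contDiff_const.sub (contDiff_ψ.smul contDiff_const)

/-- `g(T, a) = -a₁`. [folklore] -/
@[simp]
lemma bilin_vecT (y a : EuclideanSpace ℝ (Fin 2)) : bilin y (vecT y) a = -a 1 := by
  rw [bilin_apply, vecT_apply_zero, vecT_apply_one]
  ring

/-- `g(T, T) = -1`: the orienting vector field is timelike. [folklore] -/
lemma bilin_vecT_vecT (y : EuclideanSpace ℝ (Fin 2)) : bilin y (vecT y) (vecT y) < 0 := by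
  rw [bilin_vecT, vecT_apply_one]
  norm_num

/-! ### The Lorentzian half-plane -/

/-- The model with boundary `𝓡∂ 2` is the inclusion of the closed half-plane into `ℝ²`. [folklore] -/
lemma modelWithCornersEuclideanHalfSpace_apply (x : EuclideanHalfSpace 2) :
    (𝓡∂ 2) x = x.val := rfl

/-- On the model space, the derivative of `I ∘ I⁻¹` within `range I` is the identity. [folklore] -/
lemma fderivWithin_model_comp_symm (x : EuclideanHalfSpace 2) :
    fderivWithin ℝ ((𝓡∂ 2) ∘ (𝓡∂ 2).symm) (range (𝓡∂ 2)) ((𝓡∂ 2) x) =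
      ContinuousLinearMap.id ℝ _ := by
  have : fderivWithin ℝ ((𝓡∂ 2) ∘ (𝓡∂ 2).symm) (range (𝓡∂ 2)) ((𝓡∂ 2) x) =
      fderivWithin ℝ id (range (𝓡∂ 2)) ((𝓡∂ 2) x) :=
    fderivWithin_congr' (fun y hy ↦ by simp [hy]) (mem_range_self x)
  rw [this, fderivWithin_id (ModelWithCorners.uniqueDiffWithinAt_image _)]

/-- **The Lorentzian half-plane.** On the closed half-plane `ℍ = {(v, u) ∈ ℝ² : 0 ≤ v}`
(`EuclideanHalfSpace 2`, a manifold with boundary modelled on `𝓡∂ 2`) the smooth Lorentzian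
metric `g = dv² + 2ψ du dv + (ψ² - 1) du²`, `ψ = 1 - u²` (determinant `-1`). Its boundary
`v = 0` is null exactly at `u = 0` (and `u² = 2`) and timelike for `0 < u² < 2`. [folklore] -/
def metric : LorentzianMetric (𝓡∂ 2) ∞ (EuclideanHalfSpace 2) where
  val x := bilin x.val
  symm x a b := by
    show bilin x.val a b = bilin x.val b a
    rw [bilin_apply, bilin_apply]
    ring
  nondegenerate x a ha := bilin_nondegenerate x.val a ha
  contMDiff := by
    intro x₀
    rw [contMDiffAt_section]
    have : (fun x : EuclideanHalfSpace 2 ↦ (trivializationAt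
        (EuclideanSpace ℝ (Fin 2) →L[ℝ] EuclideanSpace ℝ (Fin 2) →L[ℝ] ℝ)
        (fun b : EuclideanHalfSpace 2 ↦
          TangentSpace (𝓡∂ 2) b →L[ℝ] TangentSpace (𝓡∂ 2) b →L[ℝ] ℝ) x₀
          ⟨x, (bilin x.val : TangentSpace (𝓡∂ 2) x →L[ℝ] TangentSpace (𝓡∂ 2) x →L[ℝ] ℝ)⟩).2) =
        fun x ↦ bilin x.val := by
      funext x
      ext a b
      simp [hom_trivializationAt_apply, ContinuousLinearMap.inCoordinates, TangentSpace,
        fderivWithin_model_comp_symm]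
    rw [this]
    exact (contDiff_bilin.contMDiff.comp (ModelWithCorners.contMDiff (𝓡∂ 2))).contMDiffAt
  exists_timelike x := ⟨vecT x.val, bilin_vecT_vecT x.val⟩
  pos_of_orthogonal x a b ha hab hb := bilin_pos_of_orthogonal x.val a b ha hab hb

/-- The time orientation `T = ∂ᵤ - ψ ∂ᵥ` of the Lorentzian half-plane (`g(T, T) = -1`). [folklore] -/
def timeOrientation : TimeOrientation metric where
  vectorField x := vecT x.val
  isTimelike x := bilin_vecT_vecT x.val
  contMDiff := by
    intro x₀
    rw [ModelWithCorners.tangent, contMDiffAt_section]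
    simp only [trivializationAt_model_space_apply]
    exact (contDiff_vecT.contMDiff.comp (ModelWithCorners.contMDiff (𝓡∂ 2))).contMDiffAt

/-! ### Curves in the half-plane and their velocities -/

/-- The point of the half-plane with coordinates `y = (v, u)`, `0 ≤ v`. [folklore] -/
def pt (y : EuclideanSpace ℝ (Fin 2)) (hy : 0 ≤ y 0) : EuclideanHalfSpace 2 := ⟨y, hy⟩

/-- Coordinates of `pt y hy`. [folklore] -/
@[simp] lemma pt_val (y : EuclideanSpace ℝ (Fin 2)) (hy : 0 ≤ y 0) : (pt y hy).val = y := rfl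

/-- In the charts of `ℝ` and of the half-plane, a curve `γ : ℝ → ℍ` reads as its coordinate
expression `t ↦ (γ t : ℝ²)`. [folklore] -/
lemma writtenInExtChartAt_eq (γ : ℝ → EuclideanHalfSpace 2) (s : ℝ) :
    writtenInExtChartAt 𝓘(ℝ, ℝ) (𝓡∂ 2) s γ = fun t ↦ (γ t).val := by
  funext t
  simp only [writtenInExtChartAt, Function.comp_apply, extChartAt_model_space_eq_id,
    PartialEquiv.refl_symm, PartialEquiv.refl_coe, id_eq, extChartAt_self_apply,
    modelWithCornersEuclideanHalfSpace_apply]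

/-- The velocity of a curve in the half-plane which is differentiable at `s` (in the manifold
sense) is the derivative of its coordinate expression. [folklore] -/
lemma hasDerivAt_val_of_mdifferentiableAt {γ : ℝ → EuclideanHalfSpace 2} {s : ℝ}
    (h : MDifferentiableAt 𝓘(ℝ, ℝ) (𝓡∂ 2) γ s) :
    HasDerivAt (fun t ↦ (γ t).val) (velocity (𝓡∂ 2) γ s) s := by
  have h' := h.hasMFDerivAt
  rw [HasMFDerivAt, writtenInExtChartAt_eq] at h'
  obtain ⟨-, hd⟩ := h'
  simp only [extChartAt_self_apply, modelWithCornersSelf_coe, id_eq, range_id] at hd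
  have hd' : HasFDerivAt (fun t ↦ (γ t).val)
      (mfderiv 𝓘(ℝ, ℝ) (𝓡∂ 2) γ s : ℝ →L[ℝ] EuclideanSpace ℝ (Fin 2)) s :=
    hasFDerivWithinAt_univ.mp hd
  exact hd'.hasDerivAt

/-- A curve in the half-plane given by a coordinate expression `f` differentiable at `s` is
differentiable at `s` in the manifold sense, with derivative `f'(s)`. [folklore] -/
lemma hasMFDerivAt_pt {f : ℝ → EuclideanSpace ℝ (Fin 2)} (hf : ∀ t, 0 ≤ f t 0) {s : ℝ}
    {f' : EuclideanSpace ℝ (Fin 2)} (h : HasDerivAt f f' s) :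
    HasMFDerivAt 𝓘(ℝ, ℝ) (𝓡∂ 2) (fun t ↦ pt (f t) (hf t)) s
      (ContinuousLinearMap.toSpanSingleton ℝ f') := by
  rw [HasMFDerivAt, writtenInExtChartAt_eq]
  refine ⟨?_, ?_⟩
  · exact Topology.IsInducing.subtypeVal.continuousAt_iff.mpr h.continuousAt
  · simp only [extChartAt_self_apply, modelWithCornersSelf_coe, id_eq, range_id, pt_val]
    exact h.hasFDerivAt.hasFDerivWithinAt

/-- The velocity of such a curve is `f'(s)`. [folklore] -/
lemma velocity_pt {f : ℝ → EuclideanSpace ℝ (Fin 2)} (hf : ∀ t, 0 ≤ f t 0) {s : ℝ}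
    {f' : EuclideanSpace ℝ (Fin 2)} (h : HasDerivAt f f' s) :
    velocity (𝓡∂ 2) (fun t ↦ pt (f t) (hf t)) s = f' := by
  have h1 : ContinuousLinearMap.toSpanSingleton ℝ f' (1 : ℝ) = f' := by
    rw [ContinuousLinearMap.toSpanSingleton_apply, one_smul]
  unfold velocity
  rw [(hasMFDerivAt_pt hf h).mfderiv]
  exact h1

/-! ### No timelike curve starts at the null boundary point -/

/-- The unit coordinate vector `∂ᵥ` of `ℝ²`. [folklore] -/
def e0 : EuclideanSpace ℝ (Fin 2) := EuclideanSpace.single 0 1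

/-- The unit coordinate vector `∂ᵤ` of `ℝ²`. [folklore] -/
def e1 : EuclideanSpace ℝ (Fin 2) := EuclideanSpace.single 1 1

/-- `∂ᵥ` has `v`-component `1`. [folklore] -/
@[simp] lemma e0_apply_zero : e0 0 = 1 := by simp [e0]
/-- `∂ᵥ` has `u`-component `0`. [folklore] -/
@[simp] lemma e0_apply_one : e0 1 = 0 := by simp [e0]
/-- `∂ᵤ` has `v`-component `0`. [folklore] -/
@[simp] lemma e1_apply_zero : e1 0 = 0 := by simp [e1]
/-- `∂ᵤ` has `u`-component `1`. [folklore] -/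
@[simp] lemma e1_apply_one : e1 1 = 1 := by simp [e1]

/-- The boundary curve `γ₁(s) = (0, s)`: future causal on `[0, 1]`, null at `s = 0`, timelike for
`0 < s ≤ 1`. [folklore] -/
def γ₁ : ℝ → EuclideanHalfSpace 2 := fun s ↦ pt (s • e1) (by simp)

/-- The curve `γ₂(s) = (s², 1 + s)` leaving the boundary tangentially at `γ₁ 1 = (0, 1)`: future
timelike on `[0, 1/2]`. [folklore] -/
def γ₂ : ℝ → EuclideanHalfSpace 2 := fun s ↦
  pt ((s * s) • e0 + (1 + s) • e1) (by simpa using mul_self_nonneg s)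

/-- Coordinates of `γ₁`. [folklore] -/
@[simp] lemma γ₁_val (s : ℝ) : (γ₁ s).val = s • e1 := rfl

/-- Coordinates of `γ₂`. [folklore] -/
@[simp] lemma γ₂_val (s : ℝ) : (γ₂ s).val = (s * s) • e0 + (1 + s) • e1 := rfl

/-- `γ₂` starts where `γ₁` ends: `γ₂ 0 = γ₁ 1 = (0, 1)`. [folklore] -/
lemma γ₂_zero : γ₂ 0 = γ₁ 1 := Subtype.ext (by simp)

/-- Derivative of the coordinate expression of `γ₁`. [folklore] -/
lemma hasDerivAt_f₁ (s : ℝ) : HasDerivAt (fun t : ℝ ↦ t • e1) e1 s := by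
  simpa using (hasDerivAt_id s).smul_const e1

/-- Derivative of the coordinate expression of `γ₂`. [folklore] -/
lemma hasDerivAt_f₂ (s : ℝ) :
    HasDerivAt (fun t : ℝ ↦ (t * t) • e0 + (1 + t) • e1) ((2 * s) • e0 + e1) s := by
  have h := (((hasDerivAt_id' s).mul (hasDerivAt_id' s)).smul_const e0).add
    (((hasDerivAt_id' s).const_add 1).smul_const e1)
  refine h.congr_deriv ?_
  rw [one_smul, show (1 * s + s * 1) = 2 * s by ring]

/-- `γ₁' = ∂ᵤ`. [folklore] -/
lemma velocity_γ₁ (s : ℝ) : velocity (𝓡∂ 2) γ₁ s = e1 := velocity_pt _ (hasDerivAt_f₁ s)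

/-- `γ₂'(s) = 2s ∂ᵥ + ∂ᵤ`. [folklore] -/
lemma velocity_γ₂ (s : ℝ) : velocity (𝓡∂ 2) γ₂ s = (2 * s) • e0 + e1 :=
  velocity_pt _ (hasDerivAt_f₂ s)

/-- **No curve through the corner point `γ₁ 0 = (0, 0)` is timelike there**: the `v`-coordinate
of a curve in `ℍ` has a minimum at a parameter where the curve is on the boundary, so the
velocity there is tangent to the boundary, `α ∂ᵤ`, and `g_{(0,0)}(∂ᵤ, ∂ᵤ) = ψ(0)² - 1 = 0`.
[folklore] -/
theorem not_isTimelike_velocity {γ : ℝ → EuclideanHalfSpace 2} {a : ℝ}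
    (hγ : MDifferentiableAt 𝓘(ℝ, ℝ) (𝓡∂ 2) γ a) (ha : γ a = γ₁ 0) :
    ¬ metric.IsTimelike (velocity (𝓡∂ 2) γ a) := by
  set v : EuclideanSpace ℝ (Fin 2) := velocity (𝓡∂ 2) γ a with hv
  have hd : HasDerivAt (fun t ↦ (γ t).val) v a := hasDerivAt_val_of_mdifferentiableAt hγ
  have hd0 := (EuclideanSpace.proj (0 : Fin 2)).hasFDerivAt.comp_hasDerivAt a hd
  have hmin : IsLocalMin (fun t ↦ (γ t).val 0) a := Filter.Eventually.of_forall fun t ↦ by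
    show (γ a).val 0 ≤ (γ t).val 0
    rw [ha]
    simpa using (γ t).2
  have h0 : v 0 = 0 := by simpa using hmin.hasDerivAt_eq_zero hd0
  have hu : (γ a).val 1 = 0 := by rw [ha]; simp
  intro hlt
  have hlt' : bilin (γ a).val v v < 0 := hlt
  have hzero : bilin (γ a).val v v = 0 := by
    rw [bilin_apply, ψ, hu, h0]
    ring
  rw [hzero] at hlt'
  exact lt_irrefl _ hlt'

/-- Hence **the chronological future of the corner point is empty**, `I⁺({(0,0)}) = ∅`. [folklore] -/
theorem chronologicalFuture_eq_empty :
    metric.chronologicalFuture timeOrientation {γ₁ 0} = ∅ := by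
  ext q
  simp only [mem_empty_iff_false, iff_false]
  rintro ⟨p, hp, γ, a, b, hab, hγ, hγa, -⟩
  rw [mem_singleton_iff] at hp
  obtain ⟨hd, ht, -⟩ := hγ a (left_mem_Icc.mpr hab.le)
  exact not_isTimelike_velocity hd (hγa.trans hp) ht

/-! ### But the causal future of the corner point has nonempty chronological future -/

/-- The boundary curve `γ₁` is a future causal curve on `[0, 1]`
(`g(γ₁', γ₁') = ψ² - 1 ≤ 0`, `g(T, γ₁') = -1`). [folklore] -/
theorem isFutureCausalCurveOn_γ₁ : metric.IsFutureCausalCurveOn timeOrientation γ₁ (Icc 0 1) := by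
  intro s hs
  refine ⟨(hasMFDerivAt_pt _ (hasDerivAt_f₁ s)).mdifferentiableAt, ?_⟩
  rw [velocity_γ₁]
  refine ⟨⟨?_, ?_⟩, ?_⟩
  · show bilin (γ₁ s).val e1 e1 ≤ 0
    have h1 : 0 ≤ 1 - s ^ 2 := by nlinarith [hs.1, hs.2]
    have h2 : 1 - s ^ 2 ≤ 1 := by nlinarith [hs.1, hs.2]
    simp only [γ₁_val, bilin_apply, ψ, PiLp.smul_apply, e1_apply_zero, e1_apply_one, smul_eq_mul]
    nlinarith [mul_le_mul h2 h2 h1 zero_le_one]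
  · show e1 ≠ 0
    intro h
    simpa using congrArg (fun w : EuclideanSpace ℝ (Fin 2) ↦ w 1) h
  · show bilin (γ₁ s).val (vecT (γ₁ s).val) e1 < 0
    rw [bilin_vecT, e1_apply_one]
    norm_num

/-- The curve `γ₂` is a future timelike curve on `[0, 1/2]`
(`g(γ₂', γ₂') = s⁴ - 1 < 0`, `g(T, γ₂') = -1`). [folklore] -/
theorem isFutureTimelikeCurveOn_γ₂ :
    metric.IsFutureTimelikeCurveOn timeOrientation γ₂ (Icc 0 (1 / 2)) := by
  intro s hs
  have hlt : bilin (γ₂ s).val ((2 * s) • e0 + e1) ((2 * s) • e0 + e1) < 0 := by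
    have h4 : s ^ 4 ≤ (1 / 2 : ℝ) ^ 4 := pow_le_pow_left₀ hs.1 hs.2 4
    simp only [γ₂_val, bilin_apply, ψ, PiLp.add_apply, PiLp.smul_apply, e0_apply_zero, e0_apply_one,
      e1_apply_zero, e1_apply_one, smul_eq_mul]
    nlinarith [h4]
  have hne : (2 * s) • e0 + e1 ≠ 0 := by
    intro h
    simpa using congrArg (fun w : EuclideanSpace ℝ (Fin 2) ↦ w 1) h
  have hT : bilin (γ₂ s).val (vecT (γ₂ s).val) ((2 * s) • e0 + e1) < 0 := by
    rw [bilin_vecT]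
    simp
  refine ⟨(hasMFDerivAt_pt _ (hasDerivAt_f₂ s)).mdifferentiableAt, ?_, ?_⟩
  · rw [velocity_γ₂]; exact hlt
  · rw [velocity_γ₂]; exact ⟨⟨hlt.le, hne⟩, hT⟩

/-- `γ₁ 1 = (0, 1) ∈ J⁺({(0, 0)})`. [folklore] -/
theorem mem_causalFuture : γ₁ 1 ∈ metric.causalFuture timeOrientation {γ₁ 0} :=
  Or.inr ⟨γ₁ 0, rfl, γ₁, 0, 1, zero_lt_one, isFutureCausalCurveOn_γ₁, rfl, rfl⟩

/-- `γ₂ (1/2) = (1/4, 3/2) ∈ I⁺(J⁺({(0, 0)}))`. [folklore] -/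
theorem mem_chronologicalFuture_causalFuture :
    γ₂ (1 / 2) ∈ metric.chronologicalFuture timeOrientation
      (metric.causalFuture timeOrientation {γ₁ 0}) :=
  ⟨γ₁ 1, mem_causalFuture, γ₂, 0, 1 / 2, by norm_num, isFutureTimelikeCurveOn_γ₂, γ₂_zero, rfl⟩

/-- **Push-up fails on the Lorentzian half-plane**: `I⁺(J⁺({(0,0)})) ≠ I⁺({(0,0)}) = ∅`, so the
vendored fact `LorentzianMetric.chronologicalFuture_causalFuture` (which, being a `def`, does not
bind the section's `[BoundarylessManifold I M]`, `[T2Space M]`, `[FiniteDimensional ℝ E]`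
instances) is false for this smooth metric. O'Neill's Cor. 14.1 is stated for spacetimes, i.e.
manifolds *without boundary*. [cite: ONeillSemiRiemannian1983, Ch. 14, Cor. 14.1 (pp. 402–403)] -/
theorem not_chronologicalFuture_causalFuture :
    ¬ metric.chronologicalFuture_causalFuture timeOrientation := by
  intro h
  have h2 := mem_chronologicalFuture_causalFuture
  rw [h (WithTop.coe_le_coe.mpr le_top) ({γ₁ 0} : Set (EuclideanHalfSpace 2)),
    chronologicalFuture_eq_empty] at h2
  exact Set.notMem_empty _ h2

/-- Likewise the vendored `LorentzianMetric.causalFuture_subset_closure_chronologicalFuture`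
(`J⁺(S) ⊆ closure I⁺(S)`, O'Neill 1983, Ch. 14, Lemma 14.6, again for manifolds without
boundary) is false on the Lorentzian half-plane: `(0,0) ∈ J⁺({(0,0)})` while `I⁺({(0,0)}) = ∅`.
[cite: ONeillSemiRiemannian1983, Ch. 14, Lemma 14.6 (p. 404)] -/
theorem not_causalFuture_subset_closure_chronologicalFuture :
    ¬ metric.causalFuture_subset_closure_chronologicalFuture timeOrientation := by
  intro h
  have h2 := h (WithTop.coe_le_coe.mpr le_top) ({γ₁ 0} : Set (EuclideanHalfSpace 2))
    (metric.subset_causalFuture timeOrientation _ (mem_singleton _))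
  rw [chronologicalFuture_eq_empty, closure_empty] at h2
  exact Set.notMem_empty _ h2

end HalfPlane

end Literature.Geometry.Lorentzian

end
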